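import Literature.AlgebraicGeometry.HodgeTheory.Sl2IsotypicWordLemmas
import Literature.AlgebraicGeometry.HodgeTheory.BettiUniverseCMAction
import Literature.AlgebraicGeometry.ComplexMultiplication.CMFieldActionHOne
import HarnessLib

/-!
# The crossed classes of the `𝔰𝔩₂`-isotypic letters are combinations of rational `(1,1)`-classes (Murty 1984 /
# Gordon §3: "the invariants of degree 2"; descent after Deligne LNM 900 I §3)

Family `hodge`, layer `Literature/AlgebraicGeometry/HodgeTheory`.  Cell `pub-hodgecm2` (COR-CM), seat `b27`, count-neutral
lane MT-RANK-FOUR-DIVISORS; UNCONDITIONAL, no use of HC_CM, no step towards a summit statement; everything proved, no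
definition, no named fact (D-0026).  SETTING AND NOTATION (`X`, `H = H¹(X(ℂ); ℚ)` with `dim Lie Hg ≤ 3`,
`Lie Hg ⊄ End_Hdg`, i.e. `X` not of CM type with `dim MT(H¹X) ≤ 4`; graded basis `e`, `P`, `X₀`, `E`, `F`, `Θ′ = 2P − 1`,
`α`; the pair basis `b`; `B` with slots `g` over `X` and its letters) as in the module docstring of
`HodgeTheory/Sl2IsotypicLetters`.

THIS FILE: **`sl2Cross_mem_span_rational_oneOne`** — for all slot-and-place indices `i = (s, τ)`, `j = (s', τ')` the crossed
class `g_s^* u_τ ⌣ g_{s'}^* w_{τ'} + g_{s'}^* u_{τ'} ⌣ g_s^* w_τ` lies in the `ℂ`-span of the RATIONAL `(1,1)`-classes of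
`B`.  PROOF by descent: it is the evaluation of the determinant coefficient function `δ_{(i,0)(j,1)} − δ_{(i,1)(j,0)}`, which
is killed by every trace-free `2 × 2` block (`wordDer_wordSlice_detCoeff_eq_zero`), hence by the matrices of `Θ′, E, F`
(`HodgeStructure.pairBasis_actions`), hence — in the rational letters — by the matrix of every `Y ∈ Lie Hg`; by
`mem_span_ratCast_of_forall_eq_zero` its rational-letter coefficient function is a combination of RATIONAL coefficient
functions killed by `Lie Hg`, each of which evaluates to a rational class of type `(1,1)` (killed by `Θ′ ∈ Lie Hg ⊗ ℂ`,
`wordDer_toMatrix_eq_zero_of_mem_spanC`, hence supported on words with one letter of each kind,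
`wordContent_eq_one_of_wordDer_kindDiag_eq_zero`).

## References

* [Gordon1997] B. B. Gordon, *A survey of the Hodge conjecture for abelian varieties*, App. B of Lewis, CRM Monogr.
  Ser. 10 (1999) = arXiv:alg-geom/9709030 (held `paper:arxiv-alg-geom_9709030`): §3, §7.3.2 (Murty: type (H); non-CM
  elliptic curves and QM abelian surfaces), Thm. 7.5 (Murty 1984 [B.82] / Hazama 1984 [B.47]), Def. 7.6.
* [MoonenZarhin1999LowDim] B. Moonen, Yu. Zarhin, *Hodge classes on abelian varieties of low dimension*, Math. Ann.
  315 (1999) 711–733, §2 (2.1)–(2.2).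
* [Deligne1982HodgeCycles] P. Deligne, *Hodge cycles on abelian varieties*, LNM 900 (1982), I §3 (proof of Prop. 3.4).
-/

noncomputable section

open scoped TensorProduct

namespace Literature.AlgebraicGeometry.HodgeTheory

open Literature.AlgebraicTopology.SingularHomology
open Literature.AlgebraicGeometry.Motives
open Literature.AlgebraicGeometry.Motives.HodgeStructure
open Literature.Barriers.HodgeConjecture
open Literature.RepresentationTheory.GeneralLinear
open Literature.NumberTheory.DiophantineGeometry

/-! ### §1 The crossed classes of the pair letters are combinations of rational `(1,1)`-classes -/

section Cross

variable {X B : AbelianVariety ℂ} {n : ℕ} {g : Fin n → (B ⟶ X)}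

open scoped Classical in
/-- **The crossed classes are divisorial.**  In the setting of the invariance theorem
(`AVSlots.exists_sl2Invariant_coeff`: `X` not of CM type with `dim MT(H¹X) ≤ 4` in the form `dim Lie Hg ≤ 3`,
`Lie Hg ⊄ End_Hdg`; `B` with slots `g` over `X`; pair basis `b`), for all slot-and-place indices `i = (s, τ)`,
`j = (s', τ')` the CROSSED CLASS `g_s^* u_τ ⌣ g_{s'}^* w_{τ'} + g_{s'}^* u_{τ'} ⌣ g_s^* w_τ` of the letters
(`u_τ = e τ`, `w_τ = F u_τ`) is a `ℂ`-combination of RATIONAL `(1,1)`-classes of `B` (the degree-two invariants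
`(⋀² std ⊗ Sym²)^{𝔰𝔩₂}` are divisor classes; Gordon §3 / Murty: "the invariants of degree 2").  PROOF by DESCENT
(Deligne, LNM 900 I §3): the crossed class is `∑_w a(w)·(letters)_w` for the determinant coefficient function
`a = δ_{(i,0)(j,1)} − δ_{(i,1)(j,0)}`, which is killed by every trace-free `2 × 2` block
(`wordDer_single_sub_single_eq_trace_smul`), hence by the matrices of `Θ′, E, F`, hence — transported to the rational
letters — by the matrix of every `Y ∈ Lie Hg` (`Lie Hg ⊗ ℂ = ℂΘ′ ⊕ ℂE ⊕ ℂF`); by descent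
(`mem_span_ratCast_of_forall_eq_zero`) its rational-letter coefficient function is a `ℂ`-combination of RATIONAL
coefficient functions killed by `Lie Hg`; each of these evaluates to a rational class which is of type `(1,1)`
(it is killed by `Θ′ ∈ Lie Hg ⊗ ℂ`, so in the adapted letters it is supported on words with one letter of each kind,
`wordContent_eq_one_of_wordDer_kindDiag_eq_zero`). [cite: Gordon1997, §3 and §7.3.2]
[cite: Deligne1982HodgeCycles, I §3 (proof of Prop. 3.4)] [cite: MoonenZarhin1999LowDim, §2] -/
theorem sl2Cross_mem_span_rational_oneOne [HodgeTensorFacts.{0, 0}]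
    (hHD : exists_isReal_hodgeModel) (hI : hodgePQ_independent_of_hodgeModel)
    (ψ : (BettiUniverse.hodge hHD (AbelianVariety.isSmoothProjective_holds (A := X)) 1).Polarization)
    {S : Type} [Fintype S] [DecidableEq S] {deg : S → ℤ}
    (e : Module.Basis S ℂ (ℂ ⊗[ℚ] bettiCohomology X.X 1))
    (hF : ∀ a, (BettiUniverse.hodge hHD (AbelianVariety.isSmoothProjective_holds (A := X)) 1).F a =
      Submodule.span ℂ (e '' {σ | a ≤ deg σ}))
    (hFc : ∀ a, complexConj ((BettiUniverse.hodge hHD (AbelianVariety.isSmoothProjective_holds (A := X)) 1).F a) =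
      Submodule.span ℂ (e '' {σ | deg σ ≤ 1 - a}))
    {X₀ : Module.End ℚ (bettiCohomology X.X 1)}
    (hX₀ : X₀ ∈ (BettiUniverse.hodge hHD (AbelianVariety.isSmoothProjective_holds (A := X)) 1).hodgeLie)
    (hX₀E : X₀ ∉ (BettiUniverse.hodge hHD (AbelianVariety.isSmoothProjective_holds (A := X)) 1).endAlg)
    (h3 : Module.finrank ℚ
      (BettiUniverse.hodge hHD (AbelianVariety.isSmoothProjective_holds (A := X)) 1).hodgeLie ≤ 3)
    (b : Module.Basis ({σ : S // deg σ = 1} × Fin 2) ℂ (ℂ ⊗[ℚ] bettiCohomology X.X 1))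
    (hb0 : ∀ τ, b (τ, 0) = e τ)
    (hb1 : ∀ τ, b (τ, 1) = ((1 - gradingEnd e deg) * X₀.baseChange ℂ * gradingEnd e deg) (e τ))
    (i j : Fin n × {σ : S // deg σ = 1}) :
    cupProduct (rfl : 1 + 1 = 2)
        (avLetters g (fun τr => ofRatClassBaseChange (Motives.ComplexPoints X.X) 1 (b τr)) (i.1, (i.2, 0)))
        (avLetters g (fun τr => ofRatClassBaseChange (Motives.ComplexPoints X.X) 1 (b τr)) (j.1, (j.2, 1))) +
      cupProduct (rfl : 1 + 1 = 2)
        (avLetters g (fun τr => ofRatClassBaseChange (Motives.ComplexPoints X.X) 1 (b τr)) (j.1, (j.2, 0)))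
        (avLetters g (fun τr => ofRatClassBaseChange (Motives.ComplexPoints X.X) 1 (b τr)) (i.1, (i.2, 1))) ∈
      Submodule.span ℂ {c : complexBetti B.X 2 | IsRationalClass c ∧ IsOfHodgeType B.dim B.X 2 1 1 c} := by
  classical
  -- the setting (as in `AVSlots.exists_sl2Invariant_coeff`)
  have hX : IsSmoothProjective X.dim X.X := AbelianVariety.isSmoothProjective_holds
  have hBs : IsSmoothProjective B.dim B.X := AbelianVariety.isSmoothProjective_holds
  haveI : Module.Finite ℚ (bettiCohomology X.X 1) := BettiUniverse.finite hX 1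
  set H := BettiUniverse.hodge hHD hX 1 with hHdef
  have hH : H.IsEffective := BettiUniverse.hodge_isEffective hHD hX 1
  have hdeg : ∀ σ, deg σ = 0 ∨ deg σ = 1 := fun σ => by
    have h := hH.deg_mem_Icc_of_graded e hF hFc σ
    omega
  obtain ⟨α, hα, hEb, hFb, hΘb⟩ := HodgeStructure.pairBasis_actions H ψ rfl hH e hF hFc hX₀ hX₀E h3 b hb0 hb1
  set P := gradingEnd e deg with hP
  set Y := X₀.baseChange ℂ with hY
  set E := P * Y * (1 - P) with hEdef
  set F := (1 - P) * Y * P with hFdef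
  set E01 : Matrix (Fin 2) (Fin 2) ℂ := Matrix.single 0 1 (1 : ℂ) with hE01
  set E10 : Matrix (Fin 2) (Fin 2) ℂ := Matrix.single 1 0 (1 : ℂ) with hE10
  set D : Matrix (Fin 2) (Fin 2) ℂ := Matrix.diagonal ![(1 : ℂ), -1] with hD
  -- bases indexed by `Fin M`
  set eQ := Module.finBasis ℚ (bettiCohomology X.X 1) with heQ
  set eC : Module.Basis (Fin (Module.finrank ℚ (bettiCohomology X.X 1))) ℂ
    (ℂ ⊗[ℚ] bettiCohomology X.X 1) := Algebra.TensorProduct.basis ℂ eQ with heC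
  set φ : Fin (Module.finrank ℚ (bettiCohomology X.X 1)) ≃ {σ : S // deg σ = 1} × Fin 2 :=
    eC.indexEquiv b with hφ
  set cbσ : Module.Basis (Fin (Module.finrank ℚ (bettiCohomology X.X 1))) ℂ
    (ℂ ⊗[ℚ] bettiCohomology X.X 1) := b.reindex φ.symm with hcbσdef
  have hcbσ : ∀ m, cbσ m = b (φ m) := fun m => by
    rw [hcbσdef, Module.Basis.reindex_apply, Equiv.symm_symm]
  set ρ := ofRatClassBaseChangeEquiv hX 1 with hρ
  set v : Module.Basis _ ℂ (complexBetti X.X 1) := cbσ.map ρ with hv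
  set eL : Module.Basis _ ℂ (complexBetti X.X 1) := eC.map ρ with heL
  have heLQ : ∀ i, IsRationalClass (eL i) := fun i => by
    rw [heL, Module.Basis.map_apply, heC, Algebra.TensorProduct.basis_apply, hρ,
      ofRatClassBaseChangeEquiv_apply, ofRatClassBaseChange_tmul, one_smul]
    exact isRationalClass_ofRatClass _
  set κ : Fin (Module.finrank ℚ (bettiCohomology X.X 1)) → Fin 2 := fun m => (φ m).2 with hκ
  have hv_apply : ∀ m, v m = ofRatClassBaseChange (Motives.ComplexPoints X.X) 1 (b (φ m)) := fun m => by
    rw [hv, Module.Basis.map_apply, hcbσ, hρ, ofRatClassBaseChangeEquiv_apply]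
  have hb0piece : ∀ τ : {σ : S // deg σ = 1}, b (τ, 0) ∈ H.piece 1 0 := fun τ => by
    rw [hb0]
    have h := basis_mem_piece_of_graded H e hF hFc τ
    rw [τ.2] at h
    simpa using h
  have hb1piece : ∀ τ : {σ : S // deg σ = 1}, b (τ, 1) ∈ H.piece 0 1 := fun τ => by
    have h : F (e τ) ∈ H.piece 0 (((1 : ℕ) : ℤ) - 0) := by
      rw [piece_eq_span_of_graded H e hF hFc 0, hFdef, Module.End.mul_apply, Module.End.mul_apply]
      exact one_sub_gradingEnd_apply_mem_span_zero e hdeg _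
    rw [hb1]
    simpa using h
  have hv0 : ∀ m, κ m = 0 → IsOfHodgeType X.dim X.X 1 1 0 (v m) := by
    intro m hm
    rw [hv_apply, ← BettiUniverse.mem_hodge_piece_iff hHD hI hX (k := 1) (p := 1) (q := 0) rfl]
    have h := hb0piece (φ m).1
    change (φ m).2 = 0 at hm
    rw [← hm] at h
    exact h
  have hv1 : ∀ m, κ m = 1 → IsOfHodgeType X.dim X.X 1 0 1 (v m) := by
    intro m hm
    rw [hv_apply, ← BettiUniverse.mem_hodge_piece_iff hHD hI hX (k := 1) (p := 0) (q := 1) rfl]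
    have h := hb1piece (φ m).1
    change (φ m).2 = 1 at hm
    rw [← hm] at h
    exact h
  -- change of letters
  set G : Matrix _ _ ℂ := eC.toMatrix cbσ with hG
  set G' : Matrix _ _ ℂ := cbσ.toMatrix eC with hG'
  have hGG' : G * G' = 1 := eC.toMatrix_mul_toMatrix_flip cbσ
  have hG'G : G' * G = 1 := cbσ.toMatrix_mul_toMatrix_flip eC
  let gGL : GL (Fin (Module.finrank ℚ (bettiCohomology X.X 1))) ℂ := ⟨G, G', hGG', hG'G⟩
  let gGL' : GL (Fin (Module.finrank ℚ (bettiCohomology X.X 1))) ℂ := ⟨G', G, hG'G, hGG'⟩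
  have hgGL : (gGL : Matrix _ _ ℂ) = G := rfl
  have hgGL' : (gGL' : Matrix _ _ ℂ) = G' := rfl
  have hve : ∀ m, v m = ∑ i, G i m • eL i := fun m => by
    simp only [hv, heL, Module.Basis.map_apply, ← map_smul, ← map_sum]
    congr 1
    exact (eC.sum_toMatrix_smul_self (v := ⇑cbσ) (j := m)).symm
  have hev : ∀ i, eL i = ∑ m, G' m i • v m := fun i => by
    simp only [hv, heL, Module.Basis.map_apply, ← map_smul, ← map_sum]
    congr 1
    exact (cbσ.sum_toMatrix_smul_self (v := ⇑eC) (j := i)).symm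
  have hletters : ∀ s m, avLetters g v (s, m) = ∑ i, G i m • avLetters g eL (s, i) :=
    avLetters_baseChange g G hve
  have hletters' : ∀ s i, avLetters g eL (s, i) = ∑ m, G' m i • avLetters g v (s, m) :=
    avLetters_baseChange g G' hev
  set F₂ := cupPowOneAlt ℂ (Motives.ComplexPoints B.X) 2 with hF₂def
  -- the refined letters
  set y : (Fin n × {σ : S // deg σ = 1}) × Fin 2 → complexBetti B.X 1 := fun jr =>
    avLetters g (fun τr => ofRatClassBaseChange (Motives.ComplexPoints X.X) 1 (b τr)) (jr.1.1, (jr.1.2, jr.2))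
    with hydef
  have hxy : (fun jr : (Fin n × {σ : S // deg σ = 1}) × Fin 2 => avLetters g v (jr.1.1, φ.symm (jr.1.2, jr.2))) = y := by
    funext jr
    simp only [hydef, avLetters_apply, hv_apply, Equiv.apply_symm_apply]
  -- the determinant coefficient function and its unrefined version
  set w₁ : Fin 2 → (Fin n × {σ : S // deg σ = 1}) × Fin 2 := ![(i, 0), (j, 1)] with hw₁
  set w₂ : Fin 2 → (Fin n × {σ : S // deg σ = 1}) × Fin 2 := ![(i, 1), (j, 0)] with hw₂
  set a₂ : (Fin 2 → (Fin n × {σ : S // deg σ = 1}) × Fin 2) → ℂ := Pi.single w₁ 1 - Pi.single w₂ 1 with ha₂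
  set aflat : (Fin 2 → Fin n × Fin (Module.finrank ℚ (bettiCohomology X.X 1))) → ℂ := fun w =>
    a₂ fun t => (((w t).1, (φ (w t).2).1), (φ (w t).2).2) with haflat
  have hrefine : (fun w : Fin 2 → (Fin n × {σ : S // deg σ = 1}) × Fin 2 =>
      aflat fun t => ((w t).1.1, φ.symm ((w t).1.2, (w t).2))) = a₂ := by
    funext w
    rw [haflat]
    simp only [Equiv.apply_symm_apply, Prod.mk.eta]
  -- (1) the crossed class is the evaluation of `a₂`
  have h2 : ∀ z : Fin 2 → complexBetti B.X 1, F₂ z = cupProduct (rfl : 1 + 1 = 2) (z 0) (z 1) := fun z => by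
    rw [hF₂def, cupPowOneAlt_apply, cupPowOne_succ, cupPowOne_one]
    rfl
  have heval : wordEval F₂ y a₂ =
      cupProduct (rfl : 1 + 1 = 2) (y ((i, 0))) (y ((j, 1))) + cupProduct (rfl : 1 + 1 = 2) (y ((j, 0))) (y ((i, 1))) := by
    rw [ha₂, map_sub, wordEval_single, wordEval_single, h2, h2]
    have hc : cupProduct (rfl : 1 + 1 = 2) ((y ∘ w₂) 0) ((y ∘ w₂) 1) =
        -cupProduct (rfl : 1 + 1 = 2) (y (j, 0)) (y (i, 1)) := by
      rw [cupProduct_gradedComm_holds ℂ (Motives.ComplexPoints B.X) (rfl : 1 + 1 = 2) (rfl : 1 + 1 = 2)]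
      simp [hw₂]
    rw [hc, sub_neg_eq_add]
    simp [hw₁]
  -- (2) every trace-free block kills the slices of `a₂`
  have hslice₂ : ∀ U : Fin 2 → Fin n × {σ : S // deg σ = 1}, ∀ N₀ : Matrix (Fin 2) (Fin 2) ℂ,
      N₀ 0 0 + N₀ 1 1 = 0 → wordDer ℂ N₀ (wordSlice a₂ U) = 0 := fun U N₀ htr => by
    rw [ha₂, hw₁, hw₂]
    exact wordDer_wordSlice_detCoeff_eq_zero i j U N₀ htr
  -- (3) the matrices of `Θ′, E, F` in `cbσ` kill the slices of `aflat`
  have hkill : ∀ (Z : Module.End ℂ (ℂ ⊗[ℚ] bettiCohomology X.X 1)) (N₀ : Matrix (Fin 2) (Fin 2) ℂ),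
      (∀ τ r, Z (b (τ, r)) = ∑ r', N₀ r' r • b (τ, r')) → N₀ 0 0 + N₀ 1 1 = 0 →
      ∀ u : Fin 2 → Fin n, wordDer ℂ (LinearMap.toMatrix cbσ cbσ Z) (wordSlice aflat u) = 0 := by
    intro Z N₀ hZ htr
    have hM : ∀ i' m, LinearMap.toMatrix cbσ cbσ Z i' m =
        if (φ i').1 = (φ m).1 then N₀ (φ i').2 (φ m).2 else 0 := fun i' m => by
      rw [hcbσdef]; exact toMatrix_reindex_eq_blockMatrix b φ N₀ hZ i' m
    refine (forall_wordDer_blockMatrix_eq_zero_iff φ N₀ hM aflat).2 fun U => ?_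
    rw [hrefine]
    exact hslice₂ U N₀ htr
  have hkillE := hkill E (α • E01) hEb (by rw [hE01]; simp [Matrix.single])
  have hkillF := hkill F E10 hFb (by rw [hE10]; simp [Matrix.single])
  have hkillΘ := hkill ((2 : ℂ) • P - 1) D hΘb (by rw [hD]; simp)
  -- hence the matrix of every `Y ∈ Lie Hg` (a combination of `Θ′, E, F`) kills them, in the rational letters
  set aE := colourChange G aflat with haE
  have hslice_e : ∀ u, wordSlice aE u = wordRep ℂ _ 2 gGL (wordSlice aflat u) := fun u => by
    rw [haE, ← hgGL]
    exact wordSlice_colourChange_eq_wordRep gGL aflat u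
  have hkillY : ∀ X' ∈ H.hodgeLie, ∀ u : Fin 2 → Fin n,
      wordDer ℂ (LinearMap.toMatrix eC eC (X'.baseChange ℂ)) (wordSlice aE u) = 0 := by
    intro X' hX' u
    obtain ⟨c, hc⟩ := exists_coeffs_of_mem_hodgeLieC H rfl e hF hFc hdeg hX₀ hX₀E h3 (H.baseChange_mem_hodgeLieC hX')
    rw [← hP, ← hY, ← hEdef, ← hFdef] at hc
    have hcb : wordDer ℂ (LinearMap.toMatrix cbσ cbσ (X'.baseChange ℂ)) (wordSlice aflat u) = 0 := by
      rw [hc, map_add, map_add, map_smul, map_smul, map_smul, wordDer_add, wordDer_add, wordDer_smul, wordDer_smul,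
        wordDer_smul, hkillΘ u, hkillE u, hkillF u, smul_zero, smul_zero, smul_zero, add_zero, add_zero]
    have hYG : LinearMap.toMatrix eC eC (X'.baseChange ℂ) * G = G * LinearMap.toMatrix cbσ cbσ (X'.baseChange ℂ) := by
      rw [hG, linearMap_toMatrix_mul_basis_toMatrix, basis_toMatrix_mul_linearMap_toMatrix]
    rw [hslice_e, ← wordRep_wordDer_of_mul_eq ℂ gGL hYG, hcb, map_zero]
  -- (4) descent: `aE` is a combination of RATIONAL coefficient functions killed by `Lie Hg`
  let cond : ↥H.hodgeLie × (Fin 2 → Fin n) × Word (Module.finrank ℚ (bettiCohomology X.X 1)) 2 →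
      ((Fin 2 → Fin n × Fin (Module.finrank ℚ (bettiCohomology X.X 1))) → ℚ) →ₗ[ℚ] ℚ := fun d =>
    { toFun := fun q => wordDer ℚ (LinearMap.toMatrix eQ eQ (d.1 : Module.End ℚ _)) (wordSlice q d.2.1) d.2.2
      map_add' := fun q q' => by
        rw [show wordSlice (q + q') d.2.1 = wordSlice q d.2.1 + wordSlice q' d.2.1 from rfl, map_add]; rfl
      map_smul' := fun r q => by
        rw [show wordSlice (r • q) d.2.1 = r • wordSlice q d.2.1 from rfl, map_smul]; rfl }
  let condC : ↥H.hodgeLie × (Fin 2 → Fin n) × Word (Module.finrank ℚ (bettiCohomology X.X 1)) 2 →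
      ((Fin 2 → Fin n × Fin (Module.finrank ℚ (bettiCohomology X.X 1))) → ℂ) →ₗ[ℂ] ℂ := fun d =>
    { toFun := fun a => wordDer ℂ ((LinearMap.toMatrix eQ eQ (d.1 : Module.End ℚ _)).map (algebraMap ℚ ℂ))
        (wordSlice a d.2.1) d.2.2
      map_add' := fun a a' => by
        rw [show wordSlice (a + a') d.2.1 = wordSlice a d.2.1 + wordSlice a' d.2.1 from rfl, map_add]; rfl
      map_smul' := fun r a => by
        rw [show wordSlice (r • a) d.2.1 = r • wordSlice a d.2.1 from rfl, map_smul]; rfl }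
  have hcond : ∀ d (q : (Fin 2 → Fin n × Fin (Module.finrank ℚ (bettiCohomology X.X 1))) → ℚ),
      condC d (fun w => algebraMap ℚ ℂ (q w)) = algebraMap ℚ ℂ (cond d q) := fun d q => by
    change wordDer ℂ _ (wordSlice (fun w => algebraMap ℚ ℂ (q w)) d.2.1) d.2.2 = algebraMap ℚ ℂ (wordDer ℚ _ _ _)
    rw [wordSlice_map, wordDer_map]
  have haEcond : ∀ d, condC d aE = 0 := by
    rintro ⟨⟨X', hX'⟩, u, ε⟩
    change wordDer ℂ ((LinearMap.toMatrix eQ eQ X').map (algebraMap ℚ ℂ)) (wordSlice aE u) ε = 0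
    rw [← LinearMap.toMatrix_baseChange, ← heC, hkillY X' hX' u, Pi.zero_apply]
  have hspan := mem_span_ratCast_of_forall_eq_zero cond condC hcond haEcond
  -- (5) each rational coefficient function killed by `Lie Hg` evaluates to a rational `(1,1)`-class
  have hcupB : CupPreservesHodgeType B.dim B.X :=
    cupPreservesHodgeType_of_multiplicative_deRham
      (fun F' _ _ _ ↦ Literature.NumberTheory.Transcendental.exists_deRhamIsoFamily_holds F') hBs
  obtain ⟨Mo⟩ := nonempty_hodgeModel_holds hBs
  have hΘ'C : (2 : ℂ) • P - 1 ∈ H.hodgeLieC := by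
    have h := two_smul_gradingEnd_sub_mem_hodgeLieC H e hF hFc
    rwa [show (((1 : ℕ) : ℤ) : ℂ) • (1 : Module.End ℂ (ℂ ⊗[ℚ] bettiCohomology X.X 1)) = 1 by simp] at h
  have hΘcb : LinearMap.toMatrix cbσ cbσ ((2 : ℂ) • P - 1) = kindDiag κ := by
    ext i' m
    rw [hcbσdef, toMatrix_reindex_eq_blockMatrix b φ D hΘb i' m, kindDiag, Matrix.diagonal_apply]
    by_cases him : i' = m
    · subst him
      rw [if_pos rfl, if_pos rfl, hD, Matrix.diagonal_apply_eq]
      change (![(1 : ℂ), -1]) (κ i') = _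
      rcases Fin.eq_zero_or_eq_succ (κ i') with h0 | ⟨k, hk⟩
      · rw [h0]; simp
      · have h1 : κ i' = 1 := by rw [hk, Fin.eq_zero k]; rfl
        rw [h1]; simp
    · rw [if_neg him]
      by_cases hpl : (φ i').1 = (φ m).1
      · rw [if_pos hpl, hD, Matrix.diagonal_apply_ne]
        intro hk
        exact him (φ.injective (Prod.ext hpl hk))
      · rw [if_neg hpl]
  have hgood : ∀ q : (Fin 2 → Fin n × Fin (Module.finrank ℚ (bettiCohomology X.X 1))) → ℚ,
      (∀ d, cond d q = 0) →
      IsRationalClass (wordEval F₂ (avLetters g eL) (fun w => algebraMap ℚ ℂ (q w))) ∧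
        IsOfHodgeType B.dim B.X 2 1 1 (wordEval F₂ (avLetters g eL) (fun w => algebraMap ℚ ℂ (q w))) := by
    intro q hq
    have hqX : ∀ X' ∈ H.hodgeLie, ∀ u : Fin 2 → Fin n,
        wordDer ℚ (LinearMap.toMatrix eQ eQ X') (wordSlice q u) = 0 :=
      fun X' hX' u => funext fun ε => hq (⟨X', hX'⟩, u, ε)
    refine ⟨?_, ?_⟩
    · -- rationality
      rw [wordEval_apply]
      have hr : ∀ w : Fin 2 → Fin n × Fin (Module.finrank ℚ (bettiCohomology X.X 1)),
          IsRationalClass (F₂ (avLetters g eL ∘ w)) := fun w => by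
        rw [hF₂def, cupPowOneAlt_apply]
        exact isRationalClass_cupPowOne 2 _ fun t => isRationalClass_avLetters g heLQ (w t)
      have h := isRationalClass_sum_ratCast_smul _ hr q
      refine (congrArg IsRationalClass ?_).mp h
      refine Finset.sum_congr rfl fun w _ => ?_
      rw [eq_ratCast]
    · -- type `(1,1)`: `Θ′` kills `q`, so in the adapted letters `q` lives on words with one letter of each kind
      have hΘq : ∀ u, wordDer ℂ (LinearMap.toMatrix eC eC ((2 : ℂ) • P - 1))
          (wordSlice (fun w => algebraMap ℚ ℂ (q w)) u) = 0 := fun u => by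
        rw [heC]
        exact wordDer_toMatrix_eq_zero_of_mem_spanC eQ hqX hΘ'C u
      set qb := colourChange G' (fun w => algebraMap ℚ ℂ (q w)) with hqb
      have hqbeval : wordEval F₂ (avLetters g eL) (fun w => algebraMap ℚ ℂ (q w)) = wordEval F₂ (avLetters g v) qb := by
        rw [hqb]
        exact wordEval_eq_wordEval_colourChange F₂ G' hletters' _
      have hΘG' : LinearMap.toMatrix cbσ cbσ ((2 : ℂ) • P - 1) * G' =
          G' * LinearMap.toMatrix eC eC ((2 : ℂ) • P - 1) := by
        rw [hG', linearMap_toMatrix_mul_basis_toMatrix, basis_toMatrix_mul_linearMap_toMatrix]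
      have hqbkill : ∀ u, wordDer ℂ (kindDiag κ) (wordSlice qb u) = 0 := fun u => by
        rw [hqb, ← hgGL', wordSlice_colourChange_eq_wordRep gGL', ← hΘcb]
        exact wordDer_wordRep_eq_zero_of_mul_eq ℂ gGL' hΘG' (hΘq u)
      rw [hqbeval, wordEval_eq_sum_wordSlice]
      refine IsOfHodgeType.sum hBs Mo _ _ fun u _ => IsOfHodgeType.sum hBs Mo _ _ fun ε _ => ?_
      by_cases hz : wordSlice qb u ε = 0
      · rw [hz, zero_smul]; exact IsOfHodgeType.zero Mo 2 1 1
      · refine IsOfHodgeType.smul ?_ _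
        have hk := wordContent_eq_one_of_wordDer_kindDiag_eq_zero κ (hqbkill u) hz
        rw [h2]
        -- the two letters have complementary kinds
        have htyp : ∀ t, IsOfHodgeType B.dim B.X 1 (if κ (ε t) = 0 then 1 else 0) (if κ (ε t) = 0 then 0 else 1)
            (avLetters g v (u t, ε t)) := fun t => by
          rcases Fin.eq_zero_or_eq_succ (κ (ε t)) with h0 | ⟨k, hk'⟩
          · rw [if_pos h0, if_pos h0]; exact isOfHodgeType_avLetters g (hv0 _ h0) _
          · have h1 : κ (ε t) = 1 := by rw [hk', Fin.eq_zero k]; rfl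
            rw [h1, if_neg one_ne_zero, if_neg one_ne_zero]; exact isOfHodgeType_avLetters g (hv1 _ h1) _
        have hc := hcupB (rfl : 1 + 1 = 2) (htyp 0) (htyp 1)
        have hk0 := hk 0
        have hk1 := hk 1
        simp only [wordContent, Finset.card_eq_one] at hk0 hk1
        -- count: exactly one of `κ (ε 0)`, `κ (ε 1)` is `0`
        rcases Fin.eq_zero_or_eq_succ (κ (ε 0)) with h0 | ⟨k0, hk0'⟩ <;>
          rcases Fin.eq_zero_or_eq_succ (κ (ε 1)) with h1 | ⟨k1, hk1'⟩
        · exfalso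
          obtain ⟨t, ht⟩ := hk0
          have h0t : (0 : Fin 2) ∈ ({t} : Finset (Fin 2)) := by rw [← ht]; simp [h0]
          have h1t : (1 : Fin 2) ∈ ({t} : Finset (Fin 2)) := by rw [← ht]; simp [h1]
          rw [Finset.mem_singleton] at h0t h1t
          exact zero_ne_one (h0t.trans h1t.symm)
        · have h1' : κ (ε 1) = 1 := by rw [hk1', Fin.eq_zero k1]; rfl
          rw [h0, h1', if_pos rfl, if_pos rfl, if_neg one_ne_zero, if_neg one_ne_zero] at hc
          exact hc
        · have h0' : κ (ε 0) = 1 := by rw [hk0', Fin.eq_zero k0]; rfl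
          rw [h0', h1, if_pos rfl, if_pos rfl, if_neg one_ne_zero, if_neg one_ne_zero] at hc
          exact hc
        · exfalso
          have h0' : κ (ε 0) = 1 := by rw [hk0', Fin.eq_zero k0]; rfl
          have h1' : κ (ε 1) = 1 := by rw [hk1', Fin.eq_zero k1]; rfl
          obtain ⟨t, ht⟩ := hk1
          have h0t : (0 : Fin 2) ∈ ({t} : Finset (Fin 2)) := by rw [← ht]; simp [h0']
          have h1t : (1 : Fin 2) ∈ ({t} : Finset (Fin 2)) := by rw [← ht]; simp [h1']
          rw [Finset.mem_singleton] at h0t h1t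
          exact zero_ne_one (h0t.trans h1t.symm)
  -- (6) conclusion
  have hcross : wordEval F₂ (avLetters g eL) aE ∈
      Submodule.span ℂ {c : complexBetti B.X 2 | IsRationalClass c ∧ IsOfHodgeType B.dim B.X 2 1 1 c} := by
    have h := Submodule.mem_map_of_mem (f := wordEval F₂ (avLetters g eL)) hspan
    rw [Submodule.map_span] at h
    refine (Submodule.span_le.2 ?_) h
    rintro _ ⟨_, ⟨q, hq, rfl⟩, rfl⟩
    exact Submodule.subset_span (hgood q hq)
  have hfinal : wordEval F₂ (avLetters g eL) aE = wordEval F₂ y a₂ := by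
    rw [haE, ← wordEval_eq_wordEval_colourChange F₂ G hletters aflat, ← hxy, ← hrefine]
    exact (wordEval_kindRefine F₂ φ (avLetters g v) aflat).symm
  rw [hfinal, heval] at hcross
  exact hcross

end Cross

end Literature.AlgebraicGeometry.HodgeTheory

end
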